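import Summits.NavierStokesRegularity.FluidComputer.PalasekTowerGermHostApproximantFreeRun
import Summits.NavierStokesRegularity.FluidComputer.PalasekTowerGermHostMechanismDoorAt

/-!
# The germ host AT ARBITRARY RATES `R` — THE APPROXIMABLE-AMPLIFIER DOOR AT `R`: a Schwartz mechanism datum
# whose free run meets the first-window letter of `R` is replaced, in the kernel, by a compactly supported
# approximant whose free run meets the letter with half the margin; hence `EpisodeBaseGAt R`

Cell `ns-blowup`, seat `ns-blowup-ecbridge-3` (g9; D-0074 GROUP C «BRIDGE SUPPORT», lineage
`host_preparation`; bears_on LADDER-NS N1, route `PalasekTowerBreakdown` after the RE-BASE (rev 19), live crux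
`EpisodeBaseT := EpisodeBaseGAt TowerRates.tuned` = item stmt-NavierStokesRegularity-20303). The `R`-generic
twin of `PalasekTowerGermHostApproximantFreeRun` (g7, wide): same proof by substitution `wide ↦ R`,
`Host.τfirst ↦ Host.τfirstAt R`, on the REGISTER-FREE perturbed-datum run
(`PerturbedDatum.exists_free_run_near_of_datum`, `PerturbedRun.exists_uniform_final_iteratedFDeriv_two_bound`,
`PerturbedRun.norm_fderiv_sub_le_final`, `circulation_sub_le_of_near`). LABEL: E–C typing + kernel analysis
(theorems only; no definition, no named fact, no `sorry`). WHAT THIS IS NOT: not Navier–Stokes evidence — no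
free run meeting the letter is exhibited; nothing about `RungG 1` or blow-up.

* `exists_compact_approximant_freeRunAt` — a Schwartz `W` with ONE classical finite-energy free run on
  `[1, τfirstAt R]` meeting the letter of `R` with margin `η`, and compactly supported smooth divergence-free
  speed-`< Y₀(R)` approximants at every sup distance ⟹ SOME approximant has a free run meeting the letter
  with margin `η/2`;
* **`episodeBaseGAt_of_boxNumerics_of_approximable_freeRun`** — hence, at a register-admissible `R`
  (`R.BoxNumerics c₃ r`), `EpisodeBaseGAt R` (the mechanism door at `R`, `mechanismDoorAt_of_boxNumerics`).

References: S. Palasek, arXiv:2605.13827 §4 [cite: Palasek2026ElementaryModel, §4]; T. Tao, Anal. PDE 6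
(2013) Thm. 5.4 [cite: Tao2011, Thm. 5.4 (ii)+(iv)]; J. Leray, Acta Math. 63 (1934) §19
[cite: Leray1934, §19 (3.4)–(3.8)].
-/

noncomputable section

namespace Summit.NavierStokesRegularity.FluidComputer.PalasekTowerClayBridge.Germ

open Set Function Filter Topology InnerProductSpace Metric MeasureTheory
open scoped Topology ContDiff RealInnerProductSpace ENNReal NNReal
open Literature.Analysis Literature.Analysis.FluidPDE

variable {R : TowerRates}

/-- **THE APPROXIMABLE-AMPLIFIER DOOR AT THE RATES `R`.** Let `W` be a Schwartz datum
(`HasRapidSpatialDecay W`) with ONE classical finite-energy FREE run `(v₂, q₂)` (`ν = 1`) on `[1, τfirstAt R]`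
from `v₂ 1 = W`, below `(5/3) Y₁(R) − η`, showing at `τfirstAt R`, inside `‖x‖ ≤ ρ₂` (`ρ₂ ≥ 0`), speed
`≥ Y₁(R) + η`, gradient `≥ A₁(R) + η` and an `N₁(R)`-core loop of circulation `≥ N₁(R)^{β−2} + η` (`η > 0`); and
suppose that for every `δ > 0` there is a smooth divergence-free `W'` with `tsupport W' ⊆ B̄(0, ρ')`,
`ρ₂ ≤ ρ'`, speed `< Y₀(R)` and `‖W' − W‖ ≤ δ` everywhere. Then SOME such `W'` has a classical finite-energy
FREE run on `[1, τfirstAt R]` below `(5/3) Y₁(R) − η/2` showing the three faces with margin `η/2` inside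
`‖x‖ ≤ ρ'`. [cite: Palasek2026ElementaryModel, §4] [cite: Tao2011, Thm. 5.4 (ii)+(iv)] [cite: Leray1934, §19 (3.4)–(3.8)] -/
theorem exists_compact_approximant_freeRunAt
    {W : EuclideanSpace ℝ (Fin 3) → EuclideanSpace ℝ (Fin 3)} {ρ₂ : ℝ} (hW0 : HasRapidSpatialDecay W)
    (hρ₂ : 0 ≤ ρ₂)
    {v₂ : ℝ → EuclideanSpace ℝ (Fin 3) → EuclideanSpace ℝ (Fin 3)} {q₂ : ℝ → EuclideanSpace ℝ (Fin 3) → ℝ}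
    (hv₂ : IsClassicalNSSolutionOn (Icc 1 (Host.τfirstAt R)) 1 0 v₂ q₂) (hv₂1 : v₂ 1 = W)
    (hv₂E : ∃ C : ℝ≥0∞, C < ⊤ ∧ ∀ t ∈ Icc (1 : ℝ) (Host.τfirstAt R), ∫⁻ x, ‖v₂ t x‖ₑ ^ 2 ≤ C)
    {η : ℝ} (hη : 0 < η)
    (hcap₂ : ∀ t ∈ Icc (1 : ℝ) (Host.τfirstAt R), ∀ x, ‖v₂ t x‖ ≤ 5 / 3 * R.Y 1 - η)
    (hspeed : ∃ x, ‖x‖ ≤ ρ₂ ∧ R.Y 1 + η ≤ ‖v₂ (Host.τfirstAt R) x‖)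
    (hstrain : ∃ x, ‖x‖ ≤ ρ₂ ∧ R.A 1 + η ≤ ‖fderiv ℝ (v₂ (Host.τfirstAt R)) x‖)
    (hcore : ∃ (x : EuclideanSpace ℝ (Fin 3)) (γ : ℝ → EuclideanSpace ℝ (Fin 3)),
      ‖x‖ ≤ ρ₂ ∧ ContDiff ℝ 1 γ ∧ γ 0 = γ 1 ∧
      (∀ s ∈ Icc (0 : ℝ) 1, γ s ∈ closedBall x (1 / R.N 1)) ∧
      (∀ s ∈ Icc (0 : ℝ) 1, ‖deriv γ s‖ ≤ 8 * Real.pi / R.N 1) ∧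
      R.N 1 ^ (R.β - 2) + η ≤ circulation (v₂ (Host.τfirstAt R)) γ)
    (happrox : ∀ δ : ℝ, 0 < δ → ∃ (W' : EuclideanSpace ℝ (Fin 3) → EuclideanSpace ℝ (Fin 3)) (ρ' : ℝ),
      ContDiff ℝ ∞ W' ∧ VectorCalculus.IsDivFree W' ∧ tsupport W' ⊆ closedBall 0 ρ' ∧
      (∀ x, ‖W' x‖ < R.Y 0) ∧ ρ₂ ≤ ρ' ∧ ∀ x, ‖W' x - W x‖ ≤ δ) :
    ∃ (W' : EuclideanSpace ℝ (Fin 3) → EuclideanSpace ℝ (Fin 3)) (ρ' : ℝ)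
      (u : ℝ → EuclideanSpace ℝ (Fin 3) → EuclideanSpace ℝ (Fin 3)) (p : ℝ → EuclideanSpace ℝ (Fin 3) → ℝ),
      ContDiff ℝ ∞ W' ∧ VectorCalculus.IsDivFree W' ∧ tsupport W' ⊆ closedBall 0 ρ' ∧
      (∀ x, ‖W' x‖ < R.Y 0) ∧ 0 ≤ ρ' ∧
      IsClassicalNSSolutionOn (Icc 1 (Host.τfirstAt R)) 1 0 u p ∧ u 1 = W' ∧
      (∃ C : ℝ≥0∞, C < ⊤ ∧ ∀ t ∈ Icc (1 : ℝ) (Host.τfirstAt R), ∫⁻ x, ‖u t x‖ₑ ^ 2 ≤ C) ∧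
      (∀ t ∈ Icc (1 : ℝ) (Host.τfirstAt R), ∀ x, ‖u t x‖ ≤ 5 / 3 * R.Y 1 - η / 2) ∧
      (∃ x, ‖x‖ ≤ ρ' ∧ R.Y 1 + η / 2 ≤ ‖u (Host.τfirstAt R) x‖) ∧
      (∃ x, ‖x‖ ≤ ρ' ∧ R.A 1 + η / 2 ≤ ‖fderiv ℝ (u (Host.τfirstAt R)) x‖) ∧
      (∃ (x : EuclideanSpace ℝ (Fin 3)) (γ : ℝ → EuclideanSpace ℝ (Fin 3)),
        ‖x‖ ≤ ρ' ∧ ContDiff ℝ 1 γ ∧ γ 0 = γ 1 ∧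
        (∀ s ∈ Icc (0 : ℝ) 1, γ s ∈ closedBall x (1 / R.N 1)) ∧
        (∀ s ∈ Icc (0 : ℝ) 1, ‖deriv γ s‖ ≤ 8 * Real.pi / R.N 1) ∧
        R.N 1 ^ (R.β - 2) + η / 2 ≤ circulation (u (Host.τfirstAt R)) γ) := by
  -- ### the window `[0, Wd]` in shifted time, the cap `M`
  set Wd : ℝ := Host.wfirstAt R with hWd_def
  have hWd : 0 < Wd := Host.wfirstAt_pos R
  have hτ : Host.τfirstAt R = 1 + Wd := Host.τfirstAt_eq R
  set M : ℝ := 5 / 3 * R.Y 1 with hM_def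
  have hY1 : 0 < R.Y 1 := R.Y_pos 1
  have hM : 0 < M := by positivity
  have hN1 : 0 < R.N 1 := R.N_pos 1
  set L : ℝ := 8 * Real.pi / R.N 1 with hL_def
  have hL0 : 0 ≤ L := by positivity
  -- ### the shifted free run on `[0, Wd]`
  have hmemW : ∀ {t : ℝ}, t ∈ Icc 0 Wd → t + 1 ∈ Icc (1 : ℝ) (Host.τfirstAt R) := fun ht =>
    ⟨by linarith [ht.1], by rw [hτ]; linarith [ht.2]⟩
  have hv₂' : IsClassicalNSSolutionOn (Icc 0 Wd) 1 0 (fun t => v₂ (t + 1)) (fun t => q₂ (t + 1)) :=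
    (hv₂.comp_add_right 1).mono (fun t ht => hmemW ht) (uniqueDiffOn_Icc hWd)
  have hv₂'E : ∃ C : ℝ≥0∞, C < ⊤ ∧ ∀ t ∈ Icc 0 Wd, ∫⁻ x, ‖v₂ (t + 1) x‖ₑ ^ 2 ≤ C := by
    obtain ⟨C, hC, hb⟩ := hv₂E
    exact ⟨C, hC, fun t ht => hb (t + 1) (hmemW ht)⟩
  have hv₂'bd : ∀ t ∈ Icc 0 Wd, ∀ x, ‖v₂ (t + 1) x‖ ≤ M - η := fun t ht x => hcap₂ (t + 1) (hmemW ht) x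
  have hv₂'Mb : ∀ t ∈ Icc 0 Wd, ∀ x, ‖v₂ (t + 1) x‖ ≤ M := fun t ht x =>
    (hv₂'bd t ht x).trans (by linarith)
  have hv₂'M : ∀ t ∈ Icc 0 Wd, ∀ x, ‖v₂ (t + 1) x‖ ≤ M + 1 / 2 := fun t ht x =>
    (hv₂'bd t ht x).trans (by linarith)
  have hv₂'0 : (fun t : ℝ => v₂ (t + 1)) 0 = W := by simp only [zero_add, hv₂1]
  have hv₂'0' : HasRapidSpatialDecay ((fun t : ℝ => v₂ (t + 1)) 0) := by rw [hv₂'0]; exact hW0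
  -- ### constants: second derivatives at the final time, Landau step, margins
  obtain ⟨K, hK⟩ := PerturbedRun.exists_uniform_final_iteratedFDeriv_two_bound M Wd hM hWd
  have hs0 := (Literature.Claims.NS.ClayVariants.isSmoothOnHalfSpace_zero
    (E := EuclideanSpace ℝ (Fin 3)) (F := EuclideanSpace ℝ (Fin 3)))
  have hd0 := (Literature.Claims.NS.ClayVariants.hasRapidSpaceTimeDecay_zero
    (E := EuclideanSpace ℝ (Fin 3)) (F := EuclideanSpace ℝ (Fin 3)))
  have hz0 : ∀ t : ℝ, Wd / 2 ≤ t → ∀ x : EuclideanSpace ℝ (Fin 3),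
      (0 : ℝ → EuclideanSpace ℝ (Fin 3) → EuclideanSpace ℝ (Fin 3)) t x = 0 := fun _ _ _ => rfl
  set Kp : ℝ := max K 0 with hKp
  have hKp0 : 0 ≤ Kp := le_max_right _ _
  have hKKp : K ≤ Kp := le_max_left _ _
  set h : ℝ := η / (8 * Kp + 1) with hh_def
  have hh : 0 < h := by positivity
  have hKh : (Kp + Kp) * h ≤ η / 4 := sup_aux_Kh hη hKp0
  set θ : ℝ := min (η / 4) (min (η * h / 16) (η / (4 * (L + 1)))) with hθ_def
  have hθpos : 0 < θ := lt_min (by positivity) (lt_min (by positivity) (by positivity))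
  have hθ1 : θ ≤ η / 4 := min_le_left _ _
  have hθ2 : θ ≤ η * h / 16 := (min_le_right _ _).trans (min_le_left _ _)
  have hθ3 : θ ≤ η / (4 * (L + 1)) := (min_le_right _ _).trans (min_le_right _ _)
  have hθL : 2 * θ * L ≤ η / 2 := sup_aux_θL hL0 hθpos.le hθ3
  set C₀ : ℝ := oseenSliceConst (EuclideanSpace ℝ (Fin 3)) with hC₀
  set lam : ℝ := 36 * C₀ ^ 2 * (M + (M + 1)) ^ 2 / 1 with hlam_def
  have hlam0 : 0 ≤ lam := by positivity
  set θ₂ : ℝ := min (1 / 2) θ with hθ₂_def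
  have hθ₂pos : 0 < θ₂ := lt_min (by norm_num) hθpos
  have hθ₂1 : θ₂ ≤ 1 / 2 := min_le_left _ _
  have hθ₂2 : θ₂ ≤ θ := min_le_right _ _
  set δ : ℝ := θ₂ / (2 * Real.exp (lam * Wd)) with hδ_def
  have hδpos : 0 < δ := by positivity
  have h2δ : 2 * δ * Real.exp (lam * Wd) = θ₂ := by
    rw [hδ_def]; field_simp
  clear_value Wd M L Kp h θ C₀ lam θ₂ δ
  -- ### the approximant
  obtain ⟨W', ρ', hW', hdivW', hW'supp, hW'lt, hRR', hW'W⟩ := happrox δ hδpos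
  have hρ' : 0 ≤ ρ' := hρ₂.trans hRR'
  have hW'0 : HasRapidSpatialDecay W' := HasRapidSpatialDecay.of_hasCompactSupport hW'
    ((isCompact_closedBall (0 : EuclideanSpace ℝ (Fin 3)) ρ').of_isClosed_subset (isClosed_tsupport W')
      hW'supp)
  have hD : ∀ y, ‖W' y - (fun t : ℝ => v₂ (t + 1)) 0 y‖ ≤ δ := fun y => by
    rw [hv₂'0]; exact hW'W y
  have hsmall : 2 * δ * Real.exp (36 * oseenSliceConst (EuclideanSpace ℝ (Fin 3)) ^ 2 *
      (M + (M + 1)) ^ 2 / 1 * Wd) ≤ 1 / 2 := by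
    rw [← hC₀, ← hlam_def, h2δ]; exact hθ₂1
  -- ### THE PERTURBED-DATUM RUN on `[0, Wd]`
  obtain ⟨u', p', hcl', hu'0, hE', hclose⟩ :=
    PerturbedDatum.exists_free_run_near_of_datum (v := fun t => v₂ (t + 1)) hWd hv₂' hv₂'E hM hv₂'Mb
      hW'0 hD hsmall hW' hdivW'
  have hcloseθ₂ : ∀ t ∈ Icc 0 Wd, ∀ x, ‖u' t x - v₂ (t + 1) x‖ ≤ θ₂ := by
    intro t ht x
    refine (hclose t ht x).trans ?_
    have h1 : Real.exp (36 * oseenSliceConst (EuclideanSpace ℝ (Fin 3)) ^ 2 * (M + (M + 1)) ^ 2 / 1 * t) ≤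
        Real.exp (lam * Wd) := by
      rw [← hC₀, ← hlam_def]
      exact Real.exp_le_exp.2 (mul_le_mul_of_nonneg_left ht.2 hlam0)
    calc 2 * δ * Real.exp (36 * oseenSliceConst (EuclideanSpace ℝ (Fin 3)) ^ 2 * (M + (M + 1)) ^ 2 / 1 * t)
        ≤ 2 * δ * Real.exp (lam * Wd) := mul_le_mul_of_nonneg_left h1 (by positivity)
      _ = θ₂ := h2δ
  have hcloseθ : ∀ t ∈ Icc 0 Wd, ∀ x, ‖u' t x - v₂ (t + 1) x‖ ≤ θ :=
    fun t ht x => (hcloseθ₂ t ht x).trans hθ₂2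
  have hu'bd : ∀ t ∈ Icc 0 Wd, ∀ x, ‖u' t x‖ ≤ M + 1 / 2 := by
    intro t ht x
    have h1 := hcloseθ₂ t ht x
    have h2 := hv₂'Mb t ht x
    calc ‖u' t x‖ = ‖v₂ (t + 1) x + (u' t x - v₂ (t + 1) x)‖ := by rw [add_sub_cancel]
      _ ≤ ‖v₂ (t + 1) x‖ + ‖u' t x - v₂ (t + 1) x‖ := norm_add_le _ _
      _ ≤ M + 1 / 2 := by linarith
  -- ### second derivatives at the final time and the gradient closeness
  have hWmem : Wd ∈ Icc 0 Wd := ⟨hWd.le, le_rfl⟩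
  have hu'0' : HasRapidSpatialDecay (u' 0) := by rw [hu'0]; exact hW'0
  have hKu : ∀ x, ‖iteratedFDeriv ℝ 2 (u' Wd) x‖ ≤ Kp := fun x =>
    (hK hs0 hd0 hz0 hcl' hE' hu'0' hu'bd x).trans hKKp
  have hK₂ : ∀ x, ‖iteratedFDeriv ℝ 2 ((fun t : ℝ => v₂ (t + 1)) Wd) x‖ ≤ Kp := fun x =>
    (hK hs0 hd0 hz0 hv₂' hv₂'E hv₂'0' hv₂'M x).trans hKKp
  have h2u' : ContDiff ℝ 2 (u' Wd) := (hcl'.contDiff_velocity hWmem).of_le (by norm_cast)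
  have h2v : ContDiff ℝ 2 ((fun t : ℝ => v₂ (t + 1)) Wd) :=
    (hv₂'.contDiff_velocity hWmem).of_le (by norm_cast)
  have hcl0 : ∀ x, ‖u' Wd x - (fun t : ℝ => v₂ (t + 1)) Wd x‖ ≤ θ := fun x => hcloseθ Wd hWmem x
  have herr : 2 * (θ + 0) / h + (Kp + Kp) * h ≤ η / 2 := sup_aux_err hh hθ2 hθpos.le hKh
  have hgrad : ∀ x, ‖fderiv ℝ (u' Wd) x - fderiv ℝ (v₂ (Wd + 1)) x‖ ≤ η / 2 := by
    intro x
    have hL' := PerturbedRun.norm_fderiv_sub_le_final (T := Wd) (Φ := θ) (K := Kp) (Ku := Kp) (h := h)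
      (u := fun t : ℝ => v₂ (t + 1)) (u' := u') h2v h2u' hcl0 hKu hK₂ hh x
    have : 2 * θ / h + (Kp + Kp) * h ≤ η / 2 := by simpa using herr
    exact hL'.trans this
  -- ### shift back to `[1, τfirstAt R]`: `w t = u' (t − 1)`
  set w : ℝ → EuclideanSpace ℝ (Fin 3) → EuclideanSpace ℝ (Fin 3) := fun t => u' (t + -1) with hw_def
  set r : ℝ → EuclideanSpace ℝ (Fin 3) → ℝ := fun t => p' (t + -1) with hr_def
  have hmemI : ∀ {t : ℝ}, t ∈ Icc (1 : ℝ) (Host.τfirstAt R) → t + -1 ∈ Icc 0 Wd := fun ht =>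
    ⟨by linarith [ht.1], by rw [hτ] at ht; linarith [ht.2]⟩
  have hwsol : IsClassicalNSSolutionOn (Icc 1 (Host.τfirstAt R)) 1 0 w r := by
    have h1 : IsClassicalNSSolutionOn (Icc 1 (Host.τfirstAt R)) 1
        (fun t => (0 : ℝ → EuclideanSpace ℝ (Fin 3) → EuclideanSpace ℝ (Fin 3)) (t + -1)) w r :=
      (hcl'.comp_add_right (-1)).mono (fun t ht => hmemI ht) (uniqueDiffOn_Icc (by rw [hτ]; linarith))
    exact h1
  have hwτ : w (Host.τfirstAt R) = u' Wd := by
    show u' (Host.τfirstAt R + -1) = u' Wd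
    rw [hτ]; ring_nf
  have hvτ : v₂ (Host.τfirstAt R) = v₂ (Wd + 1) := by rw [hτ, add_comm]
  have hcloseW : ∀ x, ‖u' Wd x - v₂ (Wd + 1) x‖ ≤ θ := fun x => hcloseθ Wd hWmem x
  refine ⟨W', ρ', w, r, hW', hdivW', hW'supp, hW'lt, hρ', hwsol, ?_, ?_, ?_, ?_, ?_, ?_⟩
  · -- `w 1 = W'`
    show u' (1 + -1) = W'
    rw [add_neg_cancel, hu'0]
  · -- energy
    obtain ⟨C, hC, hb⟩ := hE'
    exact ⟨C, hC, fun t ht => hb (t + -1) (hmemI ht)⟩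
  · -- the cap with margin `η/2`
    intro t ht x
    have h1 := hcloseθ (t + -1) (hmemI ht) x
    have h2 := hv₂'bd (t + -1) (hmemI ht) x
    have h3 : t + -1 + 1 = t := by ring
    rw [h3] at h1 h2
    calc ‖w t x‖ = ‖v₂ t x + (u' (t + -1) x - v₂ t x)‖ := by rw [add_sub_cancel]
      _ ≤ ‖v₂ t x‖ + ‖u' (t + -1) x - v₂ t x‖ := norm_add_le _ _
      _ ≤ (M - η) + θ := add_le_add h2 h1
      _ ≤ M - η / 2 := by linarith
  · -- the speed floor
    obtain ⟨x, hx, hfl⟩ := hspeed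
    refine ⟨x, hx.trans hRR', ?_⟩
    rw [hwτ]
    rw [hvτ] at hfl
    have h1 := hcloseW x
    have h2 : ‖v₂ (Wd + 1) x‖ ≤ ‖u' Wd x‖ + ‖u' Wd x - v₂ (Wd + 1) x‖ := by
      calc ‖v₂ (Wd + 1) x‖ = ‖u' Wd x - (u' Wd x - v₂ (Wd + 1) x)‖ := by rw [sub_sub_cancel]
        _ ≤ ‖u' Wd x‖ + ‖u' Wd x - v₂ (Wd + 1) x‖ := norm_sub_le _ _
    linarith
  · -- the strain floor
    obtain ⟨x, hx, hst⟩ := hstrain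
    refine ⟨x, hx.trans hRR', ?_⟩
    have h1 := hgrad x
    rw [hwτ]
    rw [hvτ] at hst
    have h2 : ‖fderiv ℝ (v₂ (Wd + 1)) x‖ ≤ ‖fderiv ℝ (u' Wd) x‖ +
        ‖fderiv ℝ (u' Wd) x - fderiv ℝ (v₂ (Wd + 1)) x‖ := by
      calc ‖fderiv ℝ (v₂ (Wd + 1)) x‖
          = ‖fderiv ℝ (u' Wd) x - (fderiv ℝ (u' Wd) x - fderiv ℝ (v₂ (Wd + 1)) x)‖ := by rw [sub_sub_cancel]
        _ ≤ ‖fderiv ℝ (u' Wd) x‖ + ‖fderiv ℝ (u' Wd) x - fderiv ℝ (v₂ (Wd + 1)) x‖ := norm_sub_le _ _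
    linarith
  · -- the core loop
    obtain ⟨x, γ, hx, hγ, hγ01, hγball, hγspeed, hcirc⟩ := hcore
    refine ⟨x, γ, hx.trans hRR', hγ, hγ01, hγball, hγspeed, ?_⟩
    rw [hwτ]
    rw [hvτ] at hcirc
    have hcu : Continuous (u' Wd) := (hcl'.contDiff_velocity hWmem).continuous
    have hcv : Continuous (v₂ (Wd + 1)) := by
      have := (hv₂'.contDiff_velocity hWmem).continuous; simpa using this
    have hnear : ∀ s ∈ Icc (0 : ℝ) 1, ‖u' Wd (γ s) - v₂ (Wd + 1) (γ s)‖ ≤ θ := fun s _ => hcloseW (γ s)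
    have h1 := circulation_sub_le_of_near hcv hcu hγ hγspeed hnear
    have h2 : θ * L ≤ η / 2 := by
      have := mul_nonneg hθpos.le hL0
      linarith
    linarith

/-- **`EpisodeBaseGAt R` FROM ONE FREE RUN OF A SCHWARTZ MECHANISM DATUM WITH COMPACT APPROXIMANTS** at a
register-admissible `R` (`hR : R.BoxNumerics c₃ r`): the approximable door at `R` supplies a compactly
supported datum whose free run meets the letter of `R` with margin `η/2`, and the mechanism door at `R`
(`mechanismDoorAt_of_boxNumerics`) closes. [cite: Palasek2026ElementaryModel, §4] [cite: Tao2011, Thm. 5.4 (ii)+(iv)] -/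
theorem episodeBaseGAt_of_boxNumerics_of_approximable_freeRun {c₃ r : ℝ} (hR : R.BoxNumerics c₃ r)
    {W : EuclideanSpace ℝ (Fin 3) → EuclideanSpace ℝ (Fin 3)} {ρ₂ : ℝ} (hW0 : HasRapidSpatialDecay W)
    (hρ₂ : 0 ≤ ρ₂)
    {v₂ : ℝ → EuclideanSpace ℝ (Fin 3) → EuclideanSpace ℝ (Fin 3)} {q₂ : ℝ → EuclideanSpace ℝ (Fin 3) → ℝ}
    (hv₂ : IsClassicalNSSolutionOn (Icc 1 (Host.τfirstAt R)) 1 0 v₂ q₂) (hv₂1 : v₂ 1 = W)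
    (hv₂E : ∃ C : ℝ≥0∞, C < ⊤ ∧ ∀ t ∈ Icc (1 : ℝ) (Host.τfirstAt R), ∫⁻ x, ‖v₂ t x‖ₑ ^ 2 ≤ C)
    {η : ℝ} (hη : 0 < η)
    (hcap₂ : ∀ t ∈ Icc (1 : ℝ) (Host.τfirstAt R), ∀ x, ‖v₂ t x‖ ≤ 5 / 3 * R.Y 1 - η)
    (hspeed : ∃ x, ‖x‖ ≤ ρ₂ ∧ R.Y 1 + η ≤ ‖v₂ (Host.τfirstAt R) x‖)
    (hstrain : ∃ x, ‖x‖ ≤ ρ₂ ∧ R.A 1 + η ≤ ‖fderiv ℝ (v₂ (Host.τfirstAt R)) x‖)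
    (hcore : ∃ (x : EuclideanSpace ℝ (Fin 3)) (γ : ℝ → EuclideanSpace ℝ (Fin 3)),
      ‖x‖ ≤ ρ₂ ∧ ContDiff ℝ 1 γ ∧ γ 0 = γ 1 ∧
      (∀ s ∈ Icc (0 : ℝ) 1, γ s ∈ closedBall x (1 / R.N 1)) ∧
      (∀ s ∈ Icc (0 : ℝ) 1, ‖deriv γ s‖ ≤ 8 * Real.pi / R.N 1) ∧
      R.N 1 ^ (R.β - 2) + η ≤ circulation (v₂ (Host.τfirstAt R)) γ)
    (happrox : ∀ δ : ℝ, 0 < δ → ∃ (W' : EuclideanSpace ℝ (Fin 3) → EuclideanSpace ℝ (Fin 3)) (ρ' : ℝ),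
      ContDiff ℝ ∞ W' ∧ VectorCalculus.IsDivFree W' ∧ tsupport W' ⊆ closedBall 0 ρ' ∧
      (∀ x, ‖W' x‖ < R.Y 0) ∧ ρ₂ ≤ ρ' ∧ ∀ x, ‖W' x - W x‖ ≤ δ) :
    EpisodeBaseGAt R := by
  obtain ⟨W', ρ', u, p, hW', hdivW', hW'supp, hW'lt, hρ', hu, hu1, huE, hcap, hsp, hst, hco⟩ :=
    exists_compact_approximant_freeRunAt hW0 hρ₂ hv₂ hv₂1 hv₂E hη hcap₂ hspeed hstrain hcore happrox
  exact mechanismDoorAt_of_boxNumerics hR hW' hdivW' hW'supp hW'lt hρ' hu hu1 huE (half_pos hη) hcap hsp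
    hst hco

end Summit.NavierStokesRegularity.FluidComputer.PalasekTowerClayBridge.Germ

end
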